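import Literature.AlgebraicGeometry.ShimuraVarieties.UnitaryBallHolomorphicPullback
import Literature.AlgebraicGeometry.ShimuraVarieties.UnitaryBallLocalBiholomorphy
import Literature.AlgebraicGeometry.HodgeTheory.HodgeModelFormOfClass
import Literature.AlgebraicGeometry.HodgeTheory.StandardHodgeModel
import Literature.AlgebraicGeometry.HodgeTheory.HodgeTypePullbackVanishing
import HarnessLib

/-!
# The holomorphic lift of degree-one Hodge classes of a ball quotient to the ball

Reproduction (Literature): definitions and kernel-checked consequences of tree theorems; no new
axioms, every declaration kernel-checked.

Let `X` be a compact ball quotient surface with its uniformization datum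
`D : UnitaryBallUniformisationDatum 2 X` (`X(ℂ) = Γ \ 𝔹²`, BMM Introduction §1.1) and a Sylvester frame
`𝔣`. For a class `ω ∈ F¹(ℂ ⊗_ℚ H¹(X(ℂ); ℚ))` (Voisin I §7.1.1: `F¹H¹ = H^{1,0}` is the space of
holomorphic `1`-forms, Cor. 7.6) we define its **holomorphic lift to the ball**

  `D.classLift hHD 𝔣 ω : 𝔹² → ℂ²`, `z ↦ (α_{ψ z}(dψ_z e₀), α_{ψ z}(dψ_z e₁))`,

the coefficients in `dz₀, dz₁` of the pull-back `ψ^* α` along the uniformization `ψ : 𝔹² → X^an`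
of THE holomorphic `1`-form `α` representing `ω` (Borel, §5.14: holomorphic forms on `Γ \ 𝔹` are
vector-valued automorphic forms on `𝔹`). The complex manifold `X^an` is read in the **standard
Hodge model** `stdModel hHD hX` (`HodgeTheory/StandardHodgeModel`): charts on `ℂ²` and ONE de Rham
comparison family for all surfaces, so that the lifts at different levels of a tower are
comparable. Main results (all proved):

* `continuous_classLift` — the lift is continuous (indeed holomorphic,
  `formPullback₁_mem_holomorphic`);
* `classLift_ne_zero` — a non-zero class in `F¹H¹` has a non-zero lift (the class determines a
  non-zero holomorphic form, Voisin I Cor. 7.6, and `dψ_z` is invertible, `bijective_unifDeriv`);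
* `wedge_classLift_eq_zero` — **the wedge dictionary**: if `ω₁ ∪ ω₂ = 0` in
  `ℂ ⊗_ℚ H²(X(ℂ); ℚ)` for `ω₁, ω₂ ∈ F¹H¹`, then the lifts `F = lift ω₁`, `G = lift ω₂` satisfy
  `F₀ G₁ − F₁ G₀ = 0` identically on the ball: `[α₁ ∧ α₂] = [α₁] ∪ [α₂] = Θ(ω₁ ∪ ω₂) = 0`
  (de Rham's theorem is multiplicative, Warner Thm. 5.45; `Θ` is multiplicative, Hatcher
  Prop. 3.10), and a holomorphic `2`-form on a compact surface with zero class vanishes (Voisin I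
  §7.1.1 Prop. 7.5/Cor. 7.6: `∫ α ∧ ᾱ > 0`, the tree's `closedForm_top_zero_not_exact`);
* `classLift_pull` — **compatibility with level maps**: for a morphism `f : X' ⟶ X` of ball
  quotients intertwining the uniformizations (`f(ℂ) ∘ unif' = unif` on the cone, same frame), the
  lift of `f^* ω` on `X'` equals the lift of `ω` (GAGA functoriality: `f^an` is holomorphic; the
  holomorphic representative of `f^*ω` is `(f^an)^* α`, by uniqueness of holomorphic
  representatives and naturality of the standard de Rham family; chain rule on the ball).

The pointwise ball calculus (`anMap_modelUnif`, `unifDeriv_eq_mfderiv_anMap_comp`,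
`formPullback₁_pullback_anMap`, `formPullback₁_eq_zero_iff`, `wedge_apply_unifDeriv`) is proved
for arbitrary Hodge models.

## References

* A. Borel, *Automorphic forms on `SL₂(ℝ)`* (1997), §5.14.
* N. Bergeron, J. Millson, C. Moeglin, *Hodge type theorems for arithmetic manifolds associated
  to orthogonal groups* / ball quotients (2016), Introduction §1.1.
* C. Voisin, *Hodge Theory and Complex Algebraic Geometry I* (2002), §2.2.1, §7.1.1 (Prop. 7.5,
  Cor. 7.6), §7.3.2.
* J.-P. Serre, GAGA (1956), §2 n°5 (fonctorialité).
* F. W. Warner, GTM 94 (1983), Thm. 5.45.  A. Hatcher, *Algebraic Topology* (2002), §3.2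
  Prop. 3.10.
-/

noncomputable section

open Matrix MulAction Function Set Filter
open scoped Manifold ContDiff Topology TensorProduct
open CategoryTheory
open Literature.Geometry.ComplexHyperbolic
open Literature.Geometry.ComplexHyperbolic.BallModel (U21 Ball Jac nsq actVec)
open Literature.Geometry.Kaehler (MForm IsHolomorphicInCharts holFormsInCharts isOfType_of_mem
  isHolomorphicInCharts_of_mem isSmoothForm_of_mem)
open Literature.NumberTheory.Transcendental
open Literature.AlgebraicTopology.SingularHomology
open Literature.AlgebraicGeometry.HodgeTheory
open Literature.AlgebraicGeometry.Motives (bettiCohomology ofRatClassBaseChange)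

namespace Literature.AlgebraicGeometry.ShimuraVarieties

namespace UnitaryBallUniformisationDatum

variable {X : Motives.SchemeOver ℂ} (D : UnitaryBallUniformisationDatum 2 X)

/-! ### Pointwise calculus of `formPullback₁` (any Hodge model) -/

section FormCalculus

variable (A : HodgeModel 2 X) (𝔣 : D.SylvesterFrame)

/-- **The pull-back of a holomorphic `1`-form to the ball is continuous** (it is holomorphic,
`formPullback₁_mem_holomorphic`). [cite: Borel1997, §5.14] -/
theorem continuous_formPullback₁_of_mem (α : holFormsInCharts A.model A.carrier 1) :
    Continuous (D.formPullback₁ A 𝔣 (α : MForm 𝓘(ℝ, A.model) A.carrier ℂ 1)) :=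
  BallForms.continuous_of_mem_holomorphic
    (formPullback₁_mem_holomorphic (D := D) (A := A) (𝔣 := 𝔣) (isHolomorphicInCharts_of_mem α))

/-- The one-entry vector is the constant `Fin 1`-family. [folklore] -/
theorem vecCons_fin_one_eq {V : Type*} (w : V) : ![w] = fun _ : Fin 1 ↦ w := by
  funext i
  fin_cases i
  rfl

/-- `u = u₀ e₀ + u₁ e₁` in `ℂ²`. [folklore] -/
theorem fin_two_eq_smul_single_add (u : Fin 2 → ℂ) :
    u = u 0 • (Pi.single 0 1 : Fin 2 → ℂ) + u 1 • (Pi.single 1 1 : Fin 2 → ℂ) := by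
  funext j
  fin_cases j <;> simp

variable {D A 𝔣} in
/-- **A `(1,0)`-form whose pull-back to the ball vanishes is zero**: `ψ : 𝔹² → X^an` is onto
(`exists_modelUnif_eq`) with bijective `ℂ`-linear differential (`bijective_unifDeriv`,
`unifDeriv_smul`), and a `(1,0)`-form is `ℂ`-linear in its slot. [cite: VoisinHodgeI2002, §2.2.1]
[cite: FritzscheGrauert2002, Ch. I §8 Thm. 8.5] -/
theorem eq_zero_of_formPullback₁_eq_zero {α : MForm 𝓘(ℝ, A.model) A.carrier ℂ 1}
    (hα : IsOfType 1 0 α) (h : D.formPullback₁ A 𝔣 α = 0) : α = 0 := by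
  have hlin := hα.isComplexLinearForm
  funext x
  obtain ⟨z, rfl⟩ := D.exists_modelUnif_eq A 𝔣 x
  have hi : ∀ i : Fin 2, α (D.modelUnif A 𝔣 z.1) (fun _ ↦ D.unifDeriv A 𝔣 z.1 (Pi.single i 1)) = 0 :=
    fun i ↦ by rw [← formPullback₁_apply, h]; rfl
  refine ContinuousAlternatingMap.ext fun v ↦ ?_
  show α (D.modelUnif A 𝔣 z.1) v = 0
  obtain ⟨u, hu⟩ := (D.bijective_unifDeriv A 𝔣 z).2 (v 0)
  have hv : v = fun _ ↦ v 0 := by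
    funext i
    rw [Subsingleton.elim i 0]
  rw [hv, ← hu, fin_two_eq_smul_single_add u, map_add, D.unifDeriv_smul A 𝔣 z, D.unifDeriv_smul A 𝔣 z,
    mform₁_apply_add, mform₁_apply_smul hlin, mform₁_apply_smul hlin, hi 0, hi 1]
  simp

variable {D A 𝔣} in
/-- The pull-back to the ball detects non-zero `(1,0)`-forms. [cite: VoisinHodgeI2002, §2.2.1] -/
theorem formPullback₁_eq_zero_iff {α : MForm 𝓘(ℝ, A.model) A.carrier ℂ 1} (hα : IsOfType 1 0 α) :
    D.formPullback₁ A 𝔣 α = 0 ↔ α = 0 :=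
  ⟨eq_zero_of_formPullback₁_eq_zero hα, fun h ↦ by rw [h, map_zero]⟩

/-- **The wedge of two `1`-forms read on the ball**:
`(α ∧ β)_{ψ z}(dψ_z e₀, dψ_z e₁) = F₀(z) G₁(z) − F₁(z) G₀(z)` for `F = formPullback₁ α`,
`G = formPullback₁ β` (Warner 2.10(b)). [cite: Warner1983, 2.10(b)] -/
theorem wedge_apply_unifDeriv (α β : MForm 𝓘(ℝ, A.model) A.carrier ℂ 1) (z : Ball) :
    (α.wedge β) (D.modelUnif A 𝔣 z.1)
        ![D.unifDeriv A 𝔣 z.1 (Pi.single 0 1), D.unifDeriv A 𝔣 z.1 (Pi.single 1 1)] =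
      D.formPullback₁ A 𝔣 α z 0 * D.formPullback₁ A 𝔣 β z 1 -
        D.formPullback₁ A 𝔣 α z 1 * D.formPullback₁ A 𝔣 β z 0 := by
  have key : ∀ (a b : A.model [⋀^Fin 1]→L[ℝ] ℂ) (p q : A.model),
      (a.wedge b) ![p, q] = a (fun _ ↦ p) * b (fun _ ↦ q) - a (fun _ ↦ q) * b (fun _ ↦ p) := by
    intro a b p q
    rw [ContinuousAlternatingMap.wedge_apply_one_one]
    simp only [Matrix.cons_val_zero, Matrix.cons_val_one, vecCons_fin_one_eq]
  rw [formPullback₁_apply, formPullback₁_apply, formPullback₁_apply, formPullback₁_apply]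
  exact key (α (D.modelUnif A 𝔣 z.1)) (β (D.modelUnif A 𝔣 z.1))
    (D.unifDeriv A 𝔣 z.1 (Pi.single 0 1)) (D.unifDeriv A 𝔣 z.1 (Pi.single 1 1))

end FormCalculus

/-! ### Change of level: two ball quotients, a morphism intertwining the uniformizations -/

section LevelChange

variable {X' : Motives.SchemeOver ℂ} (D' : UnitaryBallUniformisationDatum 2 X') (A : HodgeModel 2 X)
  (A' : HodgeModel 2 X') (f : X' ⟶ X) (𝔣 : D.SylvesterFrame) (𝔣' : D'.SylvesterFrame)

/-- **`f^an ∘ ψ' = ψ` on the ball** when `f(ℂ) ∘ unif' = unif` on the cone and the frames agree.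
[cite: SerreGAGA1956, §2 n°5 (fonctorialité)] [cite: BergeronMillsonMoeglin2016Balls, Introduction §1.1] -/
theorem anMap_modelUnif (hT : 𝔣'.t = 𝔣.t)
    (hf : ∀ v ∈ D'.cone, Motives.AlgPoints.map f (D'.unif v) = D.unif v) (z : Ball) :
    HodgeModel.anMap A A' f (D'.modelUnif A' 𝔣' z.1) = D.modelUnif A 𝔣 z.1 := by
  have hc : 𝔣'.t *ᵥ ![z.1 0, z.1 1, 1] ∈ D'.cone := (D'.coneLift 𝔣' z).2
  change A.isAnalytification.homeomorph.symm (Motives.AlgPoints.map f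
      (A'.toComplexPoints (D'.modelUnif A' 𝔣' z.1))) =
    A.isAnalytification.homeomorph.symm (D.unif (𝔣.t *ᵥ ![z.1 0, z.1 1, 1]))
  rw [toComplexPoints_modelUnif]
  change A.isAnalytification.homeomorph.symm (Motives.AlgPoints.map f
      (D'.unif (𝔣'.t *ᵥ ![z.1 0, z.1 1, 1]))) = _
  rw [hf _ hc, hT]

/-- Near a ball point, `ψ = f^an ∘ ψ'` (the ball is open). [folklore] -/
theorem modelUnif_eventuallyEq_anMap_comp (hT : 𝔣'.t = 𝔣.t)
    (hf : ∀ v ∈ D'.cone, Motives.AlgPoints.map f (D'.unif v) = D.unif v) (z : Ball) :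
    D.modelUnif A 𝔣 =ᶠ[𝓝 z.1] (HodgeModel.anMap A A' f ∘ D'.modelUnif A' 𝔣') := by
  filter_upwards [BallForms.isOpen_ballSet.mem_nhds (BallForms.coe_mem_ballSet z)] with w hw
  exact (D.anMap_modelUnif D' A A' f 𝔣 𝔣' hT hf ⟨w, hw⟩).symm

/-- **Chain rule `dψ_z = d(f^an)_{ψ' z} ∘ dψ'_z`** (`f^an` holomorphic, GAGA; `ψ'` holomorphic on
the ball). [cite: VoisinHodgeI2002, §2.2.1] [cite: SerreGAGA1956, §2 n°5 (fonctorialité)] -/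
theorem unifDeriv_eq_mfderiv_anMap_comp (hX : Motives.IsSmoothProjective 2 X)
    (hX' : Motives.IsSmoothProjective 2 X') (hT : 𝔣'.t = 𝔣.t)
    (hf : ∀ v ∈ D'.cone, Motives.AlgPoints.map f (D'.unif v) = D.unif v) (z : Ball) :
    D.unifDeriv A 𝔣 z.1 =
      (mfderiv 𝓘(ℝ, A'.model) 𝓘(ℝ, A.model) (HodgeModel.anMap A A' f)
        (D'.modelUnif A' 𝔣' z.1)).comp (D'.unifDeriv A' 𝔣' z.1) := by
  rw [unifDeriv, (D.modelUnif_eventuallyEq_anMap_comp D' A A' f 𝔣 𝔣' hT hf z).mfderiv_eq]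
  exact mfderiv_comp z.1
    ((HodgeModel.mdifferentiable_anMap A A' f hX' hX _).real_of_complex)
    (D'.mdifferentiableAt_modelUnif A' 𝔣' z).real_of_complex

/-- **`(f^an)^* α` pulls back to the ball (through `ψ'`) exactly as `α` does (through `ψ`)**:
`formPullback₁' ((f^an)^* α) = formPullback₁ α`. [cite: VoisinHodgeI2002, §2.2.1]
[cite: Borel1997, §5.14] -/
theorem formPullback₁_pullback_anMap (hX : Motives.IsSmoothProjective 2 X)
    (hX' : Motives.IsSmoothProjective 2 X') (hT : 𝔣'.t = 𝔣.t)
    (hf : ∀ v ∈ D'.cone, Motives.AlgPoints.map f (D'.unif v) = D.unif v)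
    (α : MForm 𝓘(ℝ, A.model) A.carrier ℂ 1) :
    D'.formPullback₁ A' 𝔣' (α.pullback 𝓘(ℝ, A'.model) (HodgeModel.anMap A A' f)) =
      D.formPullback₁ A 𝔣 α := by
  have key : ∀ {x y : A.carrier}, x = y → ∀ u : A.model, α x (fun _ ↦ u) = α y (fun _ ↦ u) := by
    intro x y h u
    subst h
    rfl
  funext z i
  rw [formPullback₁_apply, formPullback₁_apply,
    D.unifDeriv_eq_mfderiv_anMap_comp D' A A' f 𝔣 𝔣' hX hX' hT hf z]
  exact key (D.anMap_modelUnif D' A A' f 𝔣 𝔣' hT hf z) _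

end LevelChange

/-! ### The degree-one pieces `F¹H¹` read in the standard model -/

section Bridge

variable (hHD : exists_isReal_hodgeModel)

/-- `F¹(ℂ ⊗_ℚ H¹(X(ℂ); ℚ))` of the universe's Hodge structure (read in the chosen real model,
`BettiUniverse.hodge`) lies in `Θ⁻¹(H^{1,0})` of the STANDARD model (model-independence of the
Hodge type, `hI`). [cite: VoisinHodgeI2002, §6.1.3 Prop. 6.11 and §7.1.1 Def. 7.4] -/
theorem mem_ratPiece_stdModel_of_mem_hodge_F (hI : hodgePQ_independent_of_hodgeModel) {n : ℕ} (hX : Motives.IsSmoothProjective n X) {k : ℕ}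
    {c : ℂ ⊗[ℚ] bettiCohomology X k} (hc : c ∈ (BettiUniverse.hodge hHD hX k).F k) :
    c ∈ (stdModel hHD hX).ratPiece hX k k 0 := by
  rw [BettiUniverse.hodge_F] at hc
  have h1 := (BettiUniverse.realHodgeModel hHD hX).mem_ratPiece_of_mem_ratF_self hX hc
  rw [HodgeModel.mem_ratPiece_iff, HodgeModel.complexification_apply] at h1 ⊢
  exact (hI.mem_hodgePQ_iff hX _ _).1 h1

end Bridge

/-! ### The holomorphic lift of a class -/

section ClassLift

variable (hHD : exists_isReal_hodgeModel) (𝔣 : D.SylvesterFrame)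

/-- **The holomorphic lift of degree-one classes to the ball**:
`ω ↦ (z ↦ (α_{ψ z}(dψ_z e₀), α_{ψ z}(dψ_z e₁)))` where `α = oneFormOfClassSurface ω` is the
holomorphic `1`-form on `X^an` (standard model) representing the `(1,0)`-part of `Θ ω`, and
`ψ : 𝔹² → X^an` is the uniformization in the frame `𝔣`. A `ℂ`-linear map
`ℂ ⊗_ℚ H¹(X(ℂ); ℚ) → (𝔹² → ℂ²)`. [cite: Borel1997, §5.14] [cite: VoisinHodgeI2002, §7.1.1 Cor. 7.6] -/
def classLift : (ℂ ⊗[ℚ] bettiCohomology X 1) →ₗ[ℂ] (Ball → (Fin 2 → ℂ)) :=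
  D.formPullback₁ (stdModel hHD D.isSmoothProjective) 𝔣 ∘ₗ
    (holFormsInCharts _ _ 1).subtype ∘ₗ
      (stdModel hHD D.isSmoothProjective).oneFormOfClassSurface D.isSmoothProjective

/-- Unfolding `classLift`. [folklore] -/
theorem classLift_apply (c : ℂ ⊗[ℚ] bettiCohomology X 1) :
    D.classLift hHD 𝔣 c = D.formPullback₁ (stdModel hHD D.isSmoothProjective) 𝔣
      ((stdModel hHD D.isSmoothProjective).oneFormOfClassSurface D.isSmoothProjective c :
        MForm 𝓘(ℝ, Fin 2 → ℂ) (stdCarrier D.isSmoothProjective).carrier ℂ 1) :=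
  rfl

/-- `classLift ω z i = α_{ψ z}(dψ_z eᵢ)` for the holomorphic representative `α`. [folklore] -/
theorem classLift_apply_apply (c : ℂ ⊗[ℚ] bettiCohomology X 1) (z : Ball) (i : Fin 2) :
    D.classLift hHD 𝔣 c z i =
      ((stdModel hHD D.isSmoothProjective).oneFormOfClassSurface D.isSmoothProjective c :
        MForm 𝓘(ℝ, Fin 2 → ℂ) (stdCarrier D.isSmoothProjective).carrier ℂ 1)
        (D.modelUnif (stdModel hHD D.isSmoothProjective) 𝔣 z.1)
        fun _ ↦ D.unifDeriv (stdModel hHD D.isSmoothProjective) 𝔣 z.1 (Pi.single i 1) :=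
  rfl

/-- **(contEv) The holomorphic lift is continuous.** [cite: Borel1997, §5.14] -/
theorem continuous_classLift (c : ℂ ⊗[ℚ] bettiCohomology X 1) :
    Continuous (D.classLift hHD 𝔣 c) :=
  D.continuous_formPullback₁_of_mem (stdModel hHD D.isSmoothProjective) 𝔣 _

/-- The holomorphic lift is a holomorphic function on the ball. [cite: Borel1997, §5.14] -/
theorem classLift_mem_holomorphic (c : ℂ ⊗[ℚ] bettiCohomology X 1) :
    D.classLift hHD 𝔣 c ∈ BallForms.holomorphic (Fin 2 → ℂ) :=
  formPullback₁_mem_holomorphic (D := D) (A := stdModel hHD D.isSmoothProjective) (𝔣 := 𝔣)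
    (isHolomorphicInCharts_of_mem _)

/-- **(evNe) A non-zero class in `F¹H¹` has a non-zero holomorphic lift.** The class has a
non-zero holomorphic representative (Voisin I Cor. 7.6, `oneFormOfClassSurface_eq_zero_iff_of_mem_ratPiece`),
whose pull-back to the ball is non-zero (`formPullback₁_eq_zero_iff`).
[cite: VoisinHodgeI2002, §7.1.1 Cor. 7.6] [cite: Borel1997, §5.14] -/
theorem classLift_ne_zero (hI : hodgePQ_independent_of_hodgeModel) {hX : Motives.IsSmoothProjective 2 X} {c : ℂ ⊗[ℚ] bettiCohomology X 1}
    (hc : c ∈ (BettiUniverse.hodge hHD hX 1).F 1) (h0 : c ≠ 0) : D.classLift hHD 𝔣 c ≠ 0 := by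
  set A := stdModel hHD D.isSmoothProjective with hA
  have hcp : c ∈ A.ratPiece D.isSmoothProjective 1 1 0 :=
    mem_ratPiece_stdModel_of_mem_hodge_F hHD hI D.isSmoothProjective hc
  set α := A.oneFormOfClassSurface D.isSmoothProjective c with hαdef
  have hα0 : α ≠ 0 := fun h ↦
    h0 ((A.oneFormOfClassSurface_eq_zero_iff_of_mem_ratPiece D.isSmoothProjective hcp).1 h)
  intro h
  refine hα0 (Subtype.ext ?_)
  exact (formPullback₁_eq_zero_iff (D := D) (A := A) (𝔣 := 𝔣) (isOfType_of_mem α)).1 h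

/-- `Θ_A(ω₁ ∪ ω₂) = Θ_A ω₁ ∪ Θ_A ω₂` in degree `1 + 1` (the complexification is multiplicative,
`BettiUniverse.ofRatClassBaseChange_cup2`, and so is the pull-back to the model, `cupProduct_map`).
[cite: HatcherAT2002, §3.2 Prop. 3.10] -/
theorem complexification_cup_one_one {n : ℕ} (A : HodgeModel n X) (hX : Motives.IsSmoothProjective n X)
    (x y : ℂ ⊗[ℚ] bettiCohomology X 1) :
    A.complexification hX (1 + 1) (LinearMap.BilinMap.baseChange ℂ (BettiUniverse.cup X 1 1) x y) =
      cupProduct rfl (A.complexification hX 1 x) (A.complexification hX 1 y) := by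
  rw [HodgeModel.complexification_apply, HodgeModel.complexification_apply,
    HodgeModel.complexification_apply, BettiUniverse.ofRatClassBaseChange_cup2]
  exact cupProduct_map _ rfl _ _

/-- **(wedgeDict) The wedge dictionary**: if `ω₁ ∪ ω₂ = 0` (complexified rational cup product)
for `ω₁, ω₂ ∈ F¹H¹`, the lifts `F = classLift ω₁`, `G = classLift ω₂` satisfy
`F₀(z) G₁(z) − F₁(z) G₀(z) = 0` for every `z ∈ 𝔹²`. Proof: `Θ(ω₁ ∪ ω₂) = [α₁] ∪ [α₂] = [α₁ ∧ α₂]`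
(`Θ` multiplicative; de Rham multiplicative, Warner Thm. 5.45, through the standard family), so
`α₁ ∧ α₂` is an exact closed `(2,0)`-form on the compact surface `X^an`, hence zero (Voisin I
Prop. 7.5: `∫ α ∧ ᾱ > 0` for `α ≠ 0`, the tree's `closedForm_top_zero_not_exact`); evaluate at
`(dψ_z e₀, dψ_z e₁)`. [cite: VoisinHodgeI2002, §7.1.1 Prop. 7.5 and Cor. 7.6]
[cite: WarnerGTM94, Thm. 5.45] [cite: HatcherAT2002, §3.2 Prop. 3.10] -/
theorem wedge_classLift_eq_zero (hI : hodgePQ_independent_of_hodgeModel) {hX : Motives.IsSmoothProjective 2 X}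
    {c₁ c₂ : ℂ ⊗[ℚ] bettiCohomology X 1} (hc₁ : c₁ ∈ (BettiUniverse.hodge hHD hX 1).F 1)
    (hc₂ : c₂ ∈ (BettiUniverse.hodge hHD hX 1).F 1)
    (hcup : LinearMap.BilinMap.baseChange ℂ (BettiUniverse.cup X 1 1) c₁ c₂ = 0) (z : Ball) :
    D.classLift hHD 𝔣 c₁ z 0 * D.classLift hHD 𝔣 c₂ z 1 -
      D.classLift hHD 𝔣 c₁ z 1 * D.classLift hHD 𝔣 c₂ z 0 = 0 := by
  set hXD := D.isSmoothProjective
  set A := stdModel hHD hXD with hA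
  set S := stdCarrier hXD with hS
  haveI : WedgeFacts 𝓘(ℝ, Fin 2 → ℂ) S.carrier ℝ :=
    wedgeFacts_of_assoc 𝓘(ℝ, Fin 2 → ℂ) S.carrier ℝ (ContinuousAlternatingMap.WedgeAssoc_holds ℝ _ ℝ)
  haveI : WedgeFacts 𝓘(ℝ, Fin 2 → ℂ) S.carrier ℂ :=
    wedgeFacts_of_assoc 𝓘(ℝ, Fin 2 → ℂ) S.carrier ℂ (ContinuousAlternatingMap.WedgeAssoc_holds ℝ _ ℂ)
  have hcl : A.HolFormsClosed 1 := A.holFormsClosed_of_finrank_succ hXD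
  have hcp₁ : c₁ ∈ A.ratPiece hXD 1 1 0 := mem_ratPiece_stdModel_of_mem_hodge_F hHD hI hXD hc₁
  have hcp₂ : c₂ ∈ A.ratPiece hXD 1 1 0 := mem_ratPiece_stdModel_of_mem_hodge_F hHD hI hXD hc₂
  set α₁ := A.oneFormOfClassSurface hXD c₁ with hα₁
  set α₂ := A.oneFormOfClassSurface hXD c₂ with hα₂
  -- the closed forms and the wedge
  set a₁ : cclosedSmoothForms (Fin 2 → ℂ) S.carrier 1 := ⟨α₁, hcl α₁⟩ with ha₁
  set a₂ : cclosedSmoothForms (Fin 2 → ℂ) S.carrier 1 := ⟨α₂, hcl α₂⟩ with ha₂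
  set η : MForm 𝓘(ℝ, Fin 2 → ℂ) S.carrier ℂ (1 + 1) :=
    (α₁ : MForm 𝓘(ℝ, Fin 2 → ℂ) S.carrier ℂ 1).wedge (α₂ : MForm 𝓘(ℝ, Fin 2 → ℂ) S.carrier ℂ 1)
    with hη
  have hηc : η ∈ cclosedSmoothForms (Fin 2 → ℂ) S.carrier (1 + 1) :=
    wedge_mem_cclosedSmoothForms a₁.2 a₂.2
  -- `Θ cᵢ = (e ⊗ ℂ)[αᵢ]`
  have hΘ : ∀ {c : ℂ ⊗[ℚ] bettiCohomology X 1} (hc : c ∈ A.ratPiece hXD 1 1 0),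
      A.complexification hXD 1 c = complexifyFun (stdFamily 2) 1
        (complexDeRhamCohomology.mk (Fin 2 → ℂ) S.carrier 1
          ⟨(A.oneFormOfClassSurface hXD c : MForm 𝓘(ℝ, Fin 2 → ℂ) S.carrier ℂ 1),
            hcl (A.oneFormOfClassSurface hXD c)⟩) := by
    intro c hc
    rw [← A.holFormClass_oneFormOfClassSurface_of_mem_ratPiece hXD hc, HodgeModel.holFormClass_apply]
    rfl
  -- `(e ⊗ ℂ)[α₁ ∧ α₂] = Θ(c₁ ∪ c₂) = 0`
  have hclass : complexifyFun (stdFamily 2) (1 + 1)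
      (complexDeRhamCohomology.mk (Fin 2 → ℂ) S.carrier (1 + 1) ⟨η, hηc⟩) = 0 := by
    have h := complexifyFun_mk_wedge (M := S.carrier) (stdFamily_isMultiplicative 2) a₁ a₂
    rw [← hΘ hcp₁, ← hΘ hcp₂, ← complexification_cup_one_one A hXD, hcup, map_zero] at h
    exact h
  -- hence `[α₁ ∧ α₂] = 0`: `α₁ ∧ α₂` is exact
  have hmk : complexDeRhamCohomology.mk (Fin 2 → ℂ) S.carrier (1 + 1) ⟨η, hηc⟩ = 0 := by
    have h2 : (stdFamily 2).complexifyEquiv S.carrier (1 + 1)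
        (complexDeRhamCohomology.mk (Fin 2 → ℂ) S.carrier (1 + 1) ⟨η, hηc⟩) = 0 := by
      rw [complexifyEquiv_apply]; exact hclass
    exact (LinearEquiv.map_eq_zero_iff _).1 h2
  have hex : η ∈ cexactSmoothForms (Fin 2 → ℂ) S.carrier (1 + 1) := by
    have h := (complexDeRhamCohomology.mk_eq_mk_iff ⟨η, hηc⟩ 0).1 (by rw [hmk, map_zero])
    simpa using h
  -- a closed `(2,0)`-form on the compact surface which is exact vanishes
  have hηs := ((mem_cclosedSmoothForms_iff η).1 hηc).1
  have hηcl := ((mem_cclosedSmoothForms_iff η).1 hηc).2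
  have hηt : IsOfType (1 + 1) 0 η :=
    IsOfType.wedge_holds (isOfType_of_mem α₁) (isOfType_of_mem α₂)
  have hn : Module.finrank ℂ (Fin 2 → ℂ) = 1 + 1 := by simp
  have hη0 : η = 0 := by
    by_contra h0
    exact closedForm_top_zero_not_exact (1 + 1) hn η hηs hηcl hηt h0 hex
  -- evaluate at `(dψ_z e₀, dψ_z e₁)`
  have hev := D.wedge_apply_unifDeriv A 𝔣 (α₁ : MForm 𝓘(ℝ, Fin 2 → ℂ) S.carrier ℂ 1)
    (α₂ : MForm 𝓘(ℝ, Fin 2 → ℂ) S.carrier ℂ 1) z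
  rw [show (α₁ : MForm 𝓘(ℝ, Fin 2 → ℂ) S.carrier ℂ 1).wedge
      (α₂ : MForm 𝓘(ℝ, Fin 2 → ℂ) S.carrier ℂ 1) = η from rfl, hη0] at hev
  rw [classLift_apply, classLift_apply]
  have h := hev.symm
  simp only [ContinuousAlternatingMap.coe_zero, Pi.zero_apply] at h
  exact h

/-- **(saturate) Compatibility of the lift with level maps.** Let `f : X' ⟶ X` be a morphism of
ball quotient surfaces intertwining the uniformizations of the data `D'`, `D` on the cone
(`f(ℂ) ∘ unif' = unif`) and let the frames agree. Then for `ω ∈ F¹H¹(X)` the lift of `f^* ω`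
(computed on `X'`) is the lift of `ω`: the holomorphic representative of `f^*ω` is `(f^an)^* α`
(GAGA: `f^an` is holomorphic, so `(f^an)^*α` is a closed `(1,0)`-form, i.e. holomorphic, with
class `(f^an)^*[α] = Θ'(f^*ω)` by naturality of the standard de Rham family and of `Θ`;
uniqueness of holomorphic representatives, Voisin I Cor. 7.6), and `ψ = f^an ∘ ψ'` on the ball.
[cite: SerreGAGA1956, §2 n°5 (fonctorialité)] [cite: VoisinHodgeI2002, §7.1.1 Cor. 7.6 and §7.3.2]
[cite: Borel1997, §5.14] -/
theorem classLift_pull (hI : hodgePQ_independent_of_hodgeModel) {X' : Motives.SchemeOver ℂ} (D' : UnitaryBallUniformisationDatum 2 X')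
    (𝔣' : D'.SylvesterFrame) (f : X' ⟶ X) (hT : 𝔣'.t = 𝔣.t)
    (hf : ∀ v ∈ D'.cone, Motives.AlgPoints.map f (D'.unif v) = D.unif v)
    {hX : Motives.IsSmoothProjective 2 X} {c : ℂ ⊗[ℚ] bettiCohomology X 1}
    (hc : c ∈ (BettiUniverse.hodge hHD hX 1).F 1) :
    D'.classLift hHD 𝔣' ((BettiUniverse.pull f 1).baseChange ℂ c) = D.classLift hHD 𝔣 c := by
  set hXD := D.isSmoothProjective
  set hXD' := D'.isSmoothProjective
  set A := stdModel hHD hXD with hA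
  set A' := stdModel hHD hXD' with hA'
  haveI : CompleteSpace (Fin 2 → ℂ) := FiniteDimensional.complete ℂ (Fin 2 → ℂ)
  have hcl : A.HolFormsClosed 1 := A.holFormsClosed_of_finrank_succ hXD
  have hcl' : A'.HolFormsClosed 1 := A'.holFormsClosed_of_finrank_succ hXD'
  have hcp : c ∈ A.ratPiece hXD 1 1 0 := mem_ratPiece_stdModel_of_mem_hodge_F hHD hI hXD hc
  set α := A.oneFormOfClassSurface hXD c with hαdef
  -- the analytified morphism and the pulled-back form
  set φ : A'.carrier → A.carrier := HodgeModel.anMap A A' f with hφdef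
  have hφ' : MDifferentiable 𝓘(ℂ, Fin 2 → ℂ) 𝓘(ℂ, Fin 2 → ℂ) φ :=
    HodgeModel.mdifferentiable_anMap A A' f hXD' hXD
  have hφ : ContMDiff 𝓘(ℝ, Fin 2 → ℂ) 𝓘(ℝ, Fin 2 → ℂ) ∞ φ := hφ'.contMDiff_real_of_complex
  set β : MForm 𝓘(ℝ, Fin 2 → ℂ) A'.carrier ℂ 1 :=
    (α : MForm 𝓘(ℝ, Fin 2 → ℂ) A.carrier ℂ 1).pullback 𝓘(ℝ, Fin 2 → ℂ) φ with hβdef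
  have hβc : β ∈ cclosedSmoothForms (Fin 2 → ℂ) A'.carrier 1 :=
    pullback_mem_cclosedSmoothForms hφ (hcl α)
  have hβt : IsOfType 1 0 β := (isOfType_of_mem α).pullback hφ'
  have hβh : β ∈ holFormsInCharts (Fin 2 → ℂ) A'.carrier 1 :=
    mem_holFormsInCharts_of_isClosedForm_of_isOfType_one_zero
      ((mem_cclosedSmoothForms_iff β).1 hβc).1 ((mem_cclosedSmoothForms_iff β).1 hβc).2 hβt
  -- its class is `Θ'(f^* c)`
  have hclassβ : A'.holFormClass 1 hcl' ⟨β, hβh⟩ =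
      A'.complexification hXD' 1 ((BettiUniverse.pull f 1).baseChange ℂ c) := by
    rw [HodgeModel.holFormClass_apply]
    have hmk : complexDeRhamCohomology.mk (Fin 2 → ℂ) A'.carrier 1 (A'.holFormsToClosed 1 hcl' ⟨β, hβh⟩) =
        complexDeRhamCohomology.map (Fin 2 → ℂ) hφ 1
          (complexDeRhamCohomology.mk (Fin 2 → ℂ) A.carrier 1 ⟨α, hcl α⟩) := by
      rw [complexDeRhamCohomology.map_mk]
      rfl
    rw [hmk, A'.deRham_isNatural A'.carrier A.carrier φ hφ 1]
    have hΘ : A'.deRham A.carrier 1 (complexDeRhamCohomology.mk (Fin 2 → ℂ) A.carrier 1 ⟨α, hcl α⟩) =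
        A.complexification hXD 1 c := by
      rw [← A.holFormClass_oneFormOfClassSurface_of_mem_ratPiece hXD hcp, HodgeModel.holFormClass_apply]
      rfl
    rw [hΘ, HodgeModel.complexification_apply, HodgeModel.complexification_apply]
    have hnat := HodgeModel.map_anMap_pullback A A' f 1
      (ofRatClassBaseChange (Motives.ComplexPoints X) 1 c)
    rw [map_ofRatClassBaseChange _ 1 (Motives.AlgPoints.mapContinuous (L := ℂ) f)] at hnat
    exact hnat
  -- hence it IS the holomorphic representative of `f^* c`
  have hβeq : (⟨β, hβh⟩ : holFormsInCharts (Fin 2 → ℂ) A'.carrier 1) =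
      A'.oneFormOfClassSurface hXD' ((BettiUniverse.pull f 1).baseChange ℂ c) :=
    A'.eq_oneFormOfClass_of_holFormClass_eq hXD' hcl' hclassβ
  -- and the lifts agree pointwise
  rw [classLift_apply, classLift_apply, ← hβeq]
  exact D.formPullback₁_pullback_anMap D' A A' f 𝔣 𝔣' hXD hXD' hT hf _

end ClassLift

end UnitaryBallUniformisationDatum

end Literature.AlgebraicGeometry.ShimuraVarieties

end
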